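import Literature.Barriers.NavierStokesRegularity.NavierStokesInequalitySwitching
import Literature.Analysis.FluidPDE.SpaceTimeRescaling
import HarnessLib

/-!
# Scheffer's switching construction: the rescaled pieces and the glued field

Barrier catalogue support file for `NavierStokesRegularity` (D-0021). The accepted
`NavierStokesInequalitySwitching.lean` vendors the hypotheses of Ożański's switching argument as
the structure `IsNSIBlock T ν₀ τ z G u` and its conclusion as the named fact `NSISwitching`,
quantifying the glued field existentially and recording its printed formula only in docstrings.
This file DEFINES the printed objects of the construction (W. S. Ożański, arXiv:1709.00602, §2,
(2.3)–(2.4); V. Scheffer, Comm. Math. Phys. 101 (1985), proof of Lemma 2.3, p. 56), so that the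
discharge `NSISwitching_holds` can be written against named objects:

* `switchShift τ z j = c_j := Σ_{k<j} τᵏ z = Γʲ(0)`, the translation part of the iterate
  `Γʲ(y) = τʲ y + c_j` of the similarity `Γ(x) = τx + z` (`iterate_affine_apply`);
* `nsiPiece T τ z u j = u^{(j)}`, **the `j`-th rescaled copy**
  `u^{(j)}(t, x) = τ^{-j} u(τ^{-2j}(t - t_j), Γ^{-j}(x))`, `Γ^{-j}(x) = τ^{-j}(x - c_j)`,
  `t_j = switchTime T τ j` (Ożański (2.4), time first as everywhere in the tree);
* `switchIndex T τ t`, the index `j` of the switching interval `[t_j, t_{j+1})` containing `t`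
  (for `0 ≤ t < T₀ = blowupTime T τ`; junk `0`/`Nat.find` value otherwise, never used);
* `nsiGlued T τ z u = 𝔲`, **the glued field** `𝔲(t) = u^{(j)}(t)` for `t ∈ [t_j, t_{j+1})`,
  `𝔲(t) = 0` for `t ≥ T₀` (Ożański, display after (2.6)), extended by `0` to negative times
  (the fact `NSISwitching` only constrains `t ≥ 0`).

API proved here: `nsiPiece 0 = u`; `nsiPiece` as the tree's parabolic pull-back
`τ^{-j} • stPull τ^{-2j} τ^{-j} …` (`nsiPiece_eq_smul_stPull`, for the rescaling calculus of
`FluidPDE/SpaceTimeRescaling`); the values at the switching times and **the drop of magnitude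
(2.6)**, `|u^{(j+1)}(x, t_{j+1})| ≤ |u^{(j)}(x, t_{j+1})|`, from the gain (2.2)
(`IsNSIBlock.norm_nsiPiece_succ_le`); the characterisation of `switchIndex` and the three
defining clauses of `nsiGlued` (`nsiGlued_eq_nsiPiece`, `nsiGlued_eq_zero_of_le`,
`nsiGlued_eq_of_mem_Ico`).

## References

* W. S. Ożański, *On weak solutions to the Navier–Stokes inequality with internal
  singularities*, arXiv:1709.00602 (2017), §2, (2.2)–(2.6). [`Ozanski2017NSISingular`]
* V. Scheffer, *A solution to the Navier–Stokes inequality with an internal singularity*,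
  Comm. Math. Phys. 101 (1985), Lemma 2.3 and its proof (pp. 55–57). [`Scheffer1985`]
-/

noncomputable section

open MeasureTheory Set Function Filter Topology TopologicalSpace
open scoped ENNReal InnerProductSpace RealInnerProductSpace ContDiff

namespace Literature.Barriers.NavierStokesRegularity

/-! ### The iterates of the similarity `Γ(x) = τx + z` -/

/-- **The shift of the `j`-th iterate**: `c_j = Σ_{k<j} τᵏ z = Γʲ(0)`, so that
`Γʲ(y) = τʲ y + c_j` for `Γ(x) = τx + z` (Ożański 2017, §2: the nested supports `Γʲ(G)`).
[cite: Ozanski2017NSISingular, §2 (2.5)] -/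
def switchShift (τ : ℝ) (z : EuclideanSpace ℝ (Fin 3)) (j : ℕ) : EuclideanSpace ℝ (Fin 3) :=
  ∑ k ∈ Finset.range j, τ ^ k • z

/-- `c_0 = 0`. [folklore] -/
@[simp]
theorem switchShift_zero (τ : ℝ) (z : EuclideanSpace ℝ (Fin 3)) : switchShift τ z 0 = 0 := by
  simp [switchShift]

/-- `c_{j+1} = c_j + τʲ z`. [folklore] -/
theorem switchShift_succ (τ : ℝ) (z : EuclideanSpace ℝ (Fin 3)) (j : ℕ) :
    switchShift τ z (j + 1) = switchShift τ z j + τ ^ j • z := by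
  simp [switchShift, Finset.sum_range_succ]

/-- `c_{j+1} = τ c_j + z = Γ(c_j)`. [folklore] -/
theorem switchShift_succ' (τ : ℝ) (z : EuclideanSpace ℝ (Fin 3)) (j : ℕ) :
    switchShift τ z (j + 1) = τ • switchShift τ z j + z := by
  rw [switchShift, switchShift, Finset.sum_range_succ', Finset.smul_sum, pow_zero, one_smul]
  congr 1
  refine Finset.sum_congr rfl fun k _ => ?_
  rw [smul_smul, pow_succ, mul_comm]

/-- **`Γʲ(y) = τʲ y + c_j`.** [cite: Ozanski2017NSISingular, §2 (2.5)] -/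
theorem iterate_affine_apply (τ : ℝ) (z : EuclideanSpace ℝ (Fin 3)) (j : ℕ)
    (y : EuclideanSpace ℝ (Fin 3)) :
    (fun x => τ • x + z)^[j] y = τ ^ j • y + switchShift τ z j := by
  induction j with
  | zero => simp
  | succ j ih =>
    rw [Function.iterate_succ_apply', ih, switchShift_succ', smul_add, smul_smul, ← pow_succ',
      add_assoc]

/-- `Γʲ(Γ^{-j}(x)) = x` with `Γ^{-j}(x) = τ^{-j}(x - c_j)` (`τ ≠ 0`). [folklore] -/
theorem iterate_affine_inv_apply {τ : ℝ} (hτ : τ ≠ 0) (z : EuclideanSpace ℝ (Fin 3)) (j : ℕ)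
    (x : EuclideanSpace ℝ (Fin 3)) :
    (fun x => τ • x + z)^[j] ((τ⁻¹) ^ j • (x - switchShift τ z j)) = x := by
  rw [iterate_affine_apply, smul_smul, ← mul_pow, mul_inv_cancel₀ hτ, one_pow, one_smul,
    sub_add_cancel]

/-- The geometric identity behind the drop (2.6): `Γ(Γ^{-(j+1)}(x)) = Γ^{-j}(x)`, i.e.
`τ · τ^{-(j+1)}(x - c_{j+1}) + z = τ^{-j}(x - c_j)` (`τ ≠ 0`). [folklore] -/
theorem smul_inv_pow_succ_add {τ : ℝ} (hτ : τ ≠ 0) (z : EuclideanSpace ℝ (Fin 3)) (j : ℕ)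
    (x : EuclideanSpace ℝ (Fin 3)) :
    τ • ((τ⁻¹) ^ (j + 1) • (x - switchShift τ z (j + 1))) + z =
      (τ⁻¹) ^ j • (x - switchShift τ z j) := by
  have h1 : τ * (τ⁻¹) ^ (j + 1) = (τ⁻¹) ^ j := by
    rw [pow_succ', ← mul_assoc, mul_inv_cancel₀ hτ, one_mul]
  have h2 : (τ⁻¹) ^ j * τ ^ j = 1 := by rw [← mul_pow, inv_mul_cancel₀ hτ, one_pow]
  rw [switchShift_succ, smul_smul, h1, ← sub_sub, smul_sub ((τ⁻¹) ^ j) (x - switchShift τ z j),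
    smul_smul, h2, one_smul, sub_add_cancel]

/-! ### The rescaled pieces `u^{(j)}` -/

/-- **The `j`-th rescaled copy** of the block (Ożański 2017, (2.4); Scheffer 1985, p. 56):
`u^{(j)}(t, x) = τ^{-j} u(τ^{-2j}(t - t_j), Γ^{-j}(x))`, `Γ^{-j}(x) = τ^{-j}(x - c_j)`,
`t_j = switchTime T τ j` — time first. For `j = 0` this is `u` itself. Defined for every `u`
(no hypotheses); meaningful on `[t_j, t_{j+1}] × ℝ³` for a block `u` on `[0,T] × ℝ³`.
[cite: Ozanski2017NSISingular, §2 (2.4)] [cite: Scheffer1985, proof of Lemma 2.3 (p. 56)] -/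
def nsiPiece (T τ : ℝ) (z : EuclideanSpace ℝ (Fin 3))
    (u : ℝ → EuclideanSpace ℝ (Fin 3) → EuclideanSpace ℝ (Fin 3)) (j : ℕ) :
    ℝ → EuclideanSpace ℝ (Fin 3) → EuclideanSpace ℝ (Fin 3) :=
  fun t x => (τ⁻¹) ^ j • u ((τ⁻¹) ^ (2 * j) * (t - switchTime T τ j))
    ((τ⁻¹) ^ j • (x - switchShift τ z j))

section Piece

variable {T τ : ℝ} {z : EuclideanSpace ℝ (Fin 3)}
  {u : ℝ → EuclideanSpace ℝ (Fin 3) → EuclideanSpace ℝ (Fin 3)} {j : ℕ}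

/-- Unfolding `nsiPiece`. [folklore] -/
theorem nsiPiece_apply (T τ : ℝ) (z : EuclideanSpace ℝ (Fin 3))
    (u : ℝ → EuclideanSpace ℝ (Fin 3) → EuclideanSpace ℝ (Fin 3)) (j : ℕ) (t : ℝ)
    (x : EuclideanSpace ℝ (Fin 3)) :
    nsiPiece T τ z u j t x = (τ⁻¹) ^ j • u ((τ⁻¹) ^ (2 * j) * (t - switchTime T τ j))
      ((τ⁻¹) ^ j • (x - switchShift τ z j)) :=
  rfl

/-- `u^{(0)} = u` (Ożański 2017, §2: "`u^{(0)} := u`"). [cite: Ozanski2017NSISingular, §2 (2.4)] -/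
@[simp]
theorem nsiPiece_zero (T τ : ℝ) (z : EuclideanSpace ℝ (Fin 3))
    (u : ℝ → EuclideanSpace ℝ (Fin 3) → EuclideanSpace ℝ (Fin 3)) : nsiPiece T τ z u 0 = u := by
  funext t x
  simp [nsiPiece]

/-- **`u^{(j)}` is a parabolic pull-back** of `u` in the sense of the tree's
`FluidPDE/SpaceTimeRescaling`: `u^{(j)} = τ^{-j} • stPull τ^{-2j} τ^{-j} (−τ^{-2j} t_j) (−τ^{-j} c_j) u`
(time dilation `τ^{-2j}`, space dilation `τ^{-j}`, amplitude `τ^{-j}`: the Navier–Stokes scaling).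
[cite: Ozanski2017NSISingular, §2 (2.4)] -/
theorem nsiPiece_eq_smul_stPull (T τ : ℝ) (z : EuclideanSpace ℝ (Fin 3))
    (u : ℝ → EuclideanSpace ℝ (Fin 3) → EuclideanSpace ℝ (Fin 3)) (j : ℕ) :
    nsiPiece T τ z u j = (τ⁻¹) ^ j • Literature.Analysis.FluidPDE.stPull ((τ⁻¹) ^ (2 * j))
      ((τ⁻¹) ^ j) (-((τ⁻¹) ^ (2 * j) * switchTime T τ j)) (-((τ⁻¹) ^ j • switchShift τ z j)) u := by
  funext t x
  simp only [nsiPiece, Pi.smul_apply, Literature.Analysis.FluidPDE.stPull_apply]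
  congr 2
  · ring
  · rw [smul_sub]
    abel

/-- At its initial switching time the `(j+1)`-st piece is `τ^{-(j+1)} u(0, Γ^{-(j+1)} x)`. [folklore] -/
theorem nsiPiece_succ_switchTime (T τ : ℝ) (z : EuclideanSpace ℝ (Fin 3))
    (u : ℝ → EuclideanSpace ℝ (Fin 3) → EuclideanSpace ℝ (Fin 3)) (j : ℕ)
    (x : EuclideanSpace ℝ (Fin 3)) :
    nsiPiece T τ z u (j + 1) (switchTime T τ (j + 1)) x =
      (τ⁻¹) ^ (j + 1) • u 0 ((τ⁻¹) ^ (j + 1) • (x - switchShift τ z (j + 1))) := by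
  simp [nsiPiece]

/-- At its final switching time the `j`-th piece is `τ^{-j} u(T, Γ^{-j} x)`
(`τ^{-2j}(t_{j+1} - t_j) = T`, `τ ≠ 0`). [folklore] -/
theorem nsiPiece_switchTime_succ (hτ : τ ≠ 0) (T : ℝ) (z : EuclideanSpace ℝ (Fin 3))
    (u : ℝ → EuclideanSpace ℝ (Fin 3) → EuclideanSpace ℝ (Fin 3)) (j : ℕ)
    (x : EuclideanSpace ℝ (Fin 3)) :
    nsiPiece T τ z u j (switchTime T τ (j + 1)) x =
      (τ⁻¹) ^ j • u T ((τ⁻¹) ^ j • (x - switchShift τ z j)) := by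
  rw [nsiPiece_apply, switchTime_succ, add_sub_cancel_left]
  congr 2
  rw [mul_left_comm, ← mul_pow, inv_mul_cancel₀ hτ, one_pow, mul_one]

/-- **The drop of magnitude at the switching times** (Ożański 2017, (2.6); Scheffer 1985,
(2.33)): for a block, `|u^{(j+1)}(x, t_{j+1})| ≤ |u^{(j)}(x, t_{j+1})|` for all `x` — the gain
(2.2) `|u(Γy, T)| ≥ τ⁻¹|u(y, 0)|` read at `y = Γ^{-(j+1)}(x)`, `Γ(y) = Γ^{-j}(x)`.
[cite: Ozanski2017NSISingular, §2 (2.6)] [cite: Scheffer1985, (2.33)] -/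
theorem IsNSIBlock.norm_nsiPiece_succ_le {ν₀ : ℝ} {G : Set (EuclideanSpace ℝ (Fin 3))}
    (h : IsNSIBlock T ν₀ τ z G u) (j : ℕ) (x : EuclideanSpace ℝ (Fin 3)) :
    ‖nsiPiece T τ z u (j + 1) (switchTime T τ (j + 1)) x‖ ≤
      ‖nsiPiece T τ z u j (switchTime T τ (j + 1)) x‖ := by
  have hτ : τ ≠ 0 := h.τ_pos.ne'
  have hτi : 0 ≤ τ⁻¹ := inv_nonneg.2 h.τ_pos.le
  rw [nsiPiece_succ_switchTime, nsiPiece_switchTime_succ hτ, norm_smul, norm_smul,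
    ← smul_inv_pow_succ_add hτ z j x]
  set y : EuclideanSpace ℝ (Fin 3) := (τ⁻¹) ^ (j + 1) • (x - switchShift τ z (j + 1)) with hy
  have hg := h.gain y
  rw [Real.norm_of_nonneg (pow_nonneg hτi _), Real.norm_of_nonneg (pow_nonneg hτi _), pow_succ,
    mul_assoc]
  exact mul_le_mul_of_nonneg_left hg (pow_nonneg hτi _)

end Piece

/-! ### The switching index and the glued field -/

open Classical in
/-- **The index of the switching interval containing `t`**: the least `j` with `t < t_{j+1}`
(so `t ∈ [t_j, t_{j+1})` when `0 ≤ t < T₀`, `switchIndex_spec`); junk value `0` when no such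
`j` exists (`t ≥ T₀`), never used. [cite: Ozanski2017NSISingular, §2 (2.3)] -/
def switchIndex (T τ t : ℝ) : ℕ :=
  if h : ∃ j : ℕ, t < switchTime T τ (j + 1) then Nat.find h else 0

/-- **The glued field** `𝔲` (Ożański 2017, §2, display after (2.6); Scheffer 1985, p. 56):
`𝔲(t) = u^{(j)}(t)` for `t ∈ [t_j, t_{j+1})`, `j ≥ 0`, and `𝔲(t) = 0` for `t ≥ T₀ = T/(1-τ²)`;
extended by `0` to `t < 0` (outside the scope of the printed statement, which concerns
`ℝ³ × [0, ∞)`). [cite: Ozanski2017NSISingular, §2 (2.4)–(2.6)] [cite: Scheffer1985, proof of Lemma 2.3 (p. 56)] -/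
def nsiGlued (T τ : ℝ) (z : EuclideanSpace ℝ (Fin 3))
    (u : ℝ → EuclideanSpace ℝ (Fin 3) → EuclideanSpace ℝ (Fin 3)) :
    ℝ → EuclideanSpace ℝ (Fin 3) → EuclideanSpace ℝ (Fin 3) :=
  fun t x => if 0 ≤ t ∧ t < blowupTime T τ then nsiPiece T τ z u (switchIndex T τ t) t x else 0

section Glued

variable {T τ : ℝ} {z : EuclideanSpace ℝ (Fin 3)}
  {u : ℝ → EuclideanSpace ℝ (Fin 3) → EuclideanSpace ℝ (Fin 3)}

/-- The switching times are nonnegative (`T > 0`, `τ > 0`). [folklore] -/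
theorem switchTime_nonneg (hT : 0 < T) (hτ : 0 < τ) (j : ℕ) : 0 ≤ switchTime T τ j := by
  have := (strictMono_switchTime hT hτ).monotone (Nat.zero_le j)
  rwa [switchTime_zero] at this

/-- Below the blow-up time every `t` lies below some switching time. [folklore] -/
theorem exists_lt_switchTime (hτ0 : 0 ≤ τ) (hτ1 : τ < 1) {t : ℝ} (ht : t < blowupTime T τ) :
    ∃ j : ℕ, t < switchTime T τ (j + 1) := by
  have hev := (tendsto_switchTime (T := T) hτ0 hτ1).eventually (lt_mem_nhds ht)
  obtain ⟨N, hN⟩ := eventually_atTop.1 hev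
  exact ⟨N, hN (N + 1) (Nat.le_succ N)⟩

/-- **`switchIndex` locates `t`**: for `0 ≤ t < T₀`, `t ∈ [t_J, t_{J+1})` with
`J = switchIndex T τ t`. [cite: Ozanski2017NSISingular, §2 (2.3)] -/
theorem switchIndex_spec (hτ0 : 0 ≤ τ) (hτ1 : τ < 1) {t : ℝ} (ht0 : 0 ≤ t)
    (ht : t < blowupTime T τ) :
    t ∈ Ico (switchTime T τ (switchIndex T τ t)) (switchTime T τ (switchIndex T τ t + 1)) := by
  have hex := exists_lt_switchTime hτ0 hτ1 ht
  rw [switchIndex, dif_pos hex]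
  refine ⟨?_, Nat.find_spec hex⟩
  rcases Nat.eq_zero_or_pos (Nat.find hex) with h0 | hpos
  · rw [h0, switchTime_zero]
    exact ht0
  · obtain ⟨k, hk⟩ : ∃ k, Nat.find hex = k + 1 := ⟨Nat.find hex - 1, by omega⟩
    have hmin : ¬ t < switchTime T τ (k + 1) := Nat.find_min hex (by omega)
    rw [hk]
    exact not_lt.1 hmin

/-- On `[t_j, t_{j+1})` the switching index is `j` (the switching times increase).
[cite: Ozanski2017NSISingular, §2 (2.3)] -/
theorem switchIndex_eq_of_mem (hT : 0 < T) (hτ : 0 < τ) {t : ℝ} {j : ℕ}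
    (ht : t ∈ Ico (switchTime T τ j) (switchTime T τ (j + 1))) : switchIndex T τ t = j := by
  have hex : ∃ j : ℕ, t < switchTime T τ (j + 1) := ⟨j, ht.2⟩
  rw [switchIndex, dif_pos hex, Nat.find_eq_iff]
  refine ⟨ht.2, fun k hk hlt => ?_⟩
  have hmono := (strictMono_switchTime hT hτ).monotone (show k + 1 ≤ j by omega)
  linarith [ht.1]

/-- **First clause of the gluing**: `𝔲(t) = u^{(j)}(t)` for `t ∈ [t_j, t_{j+1})`.
[cite: Ozanski2017NSISingular, §2 (2.4)] -/
theorem nsiGlued_eq_nsiPiece (hT : 0 < T) (hτ0 : 0 < τ) (hτ1 : τ < 1) {t : ℝ} {j : ℕ}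
    (ht : t ∈ Ico (switchTime T τ j) (switchTime T τ (j + 1))) :
    nsiGlued T τ z u t = nsiPiece T τ z u j t := by
  funext x
  have ht0 : 0 ≤ t := (switchTime_nonneg hT hτ0 j).trans ht.1
  have htT : t < blowupTime T τ := ht.2.trans (switchTime_lt_blowupTime hT hτ0 hτ1 (j + 1))
  simp only [nsiGlued, ht0, htT, and_self, if_true, switchIndex_eq_of_mem hT hτ0 ht]

/-- **Second clause of the gluing**: `𝔲(t) = 0` for `t ≥ T₀`. [cite: Ozanski2017NSISingular, §2 (2.4)] -/
theorem nsiGlued_eq_zero_of_le {t : ℝ} (ht : blowupTime T τ ≤ t) : nsiGlued T τ z u t = 0 := by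
  funext x
  simp [nsiGlued, not_lt.2 ht]

/-- The (conventional) extension by zero to negative times. [folklore] -/
theorem nsiGlued_eq_zero_of_neg {t : ℝ} (ht : t < 0) : nsiGlued T τ z u t = 0 := by
  funext x
  simp [nsiGlued, not_le.2 ht]

/-- For `0 ≤ t < T₀` the glued field is the piece selected by `switchIndex`. [folklore] -/
theorem nsiGlued_eq_nsiPiece_switchIndex {t : ℝ} (ht0 : 0 ≤ t) (ht : t < blowupTime T τ) :
    nsiGlued T τ z u t = nsiPiece T τ z u (switchIndex T τ t) t := by
  funext x
  simp [nsiGlued, ht0, ht]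

/-- **`𝔲 = u` on `[0, T)`** (the piece `j = 0`). [cite: Ozanski2017NSISingular, §2 (2.4)] -/
theorem nsiGlued_eq_of_mem_Ico (hT : 0 < T) (hτ0 : 0 < τ) (hτ1 : τ < 1) {t : ℝ}
    (ht : t ∈ Ico 0 T) : nsiGlued T τ z u t = u t := by
  have ht' : t ∈ Ico (switchTime T τ 0) (switchTime T τ (0 + 1)) := by simpa using ht
  rw [nsiGlued_eq_nsiPiece hT hτ0 hτ1 ht', nsiPiece_zero]

end Glued

end Literature.Barriers.NavierStokesRegularity

end
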